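import Summits.ResolutionOfSingularities.ResolutionOfSingularities.Theorems.FrobeniusLadderFRationalResolutionDivisorialGcd
import Summits.ResolutionOfSingularities.ResolutionOfSingularities.Theorems.FrobeniusLadderFRationalResolutionGradedLocalPrincipal
import Mathlib.Data.Set.Finite.Lattice
import HarnessLib

/-!
# Crux `FrobeniusLadder.FRationalResolution` (stmt-ResolutionOfSingularities-15317), line `redirect`,
# stub `stub_diagonalizableQuotientResolution` — ★★★ THE DEGREE-ZERO SUBRING OF A GRADED LOCAL UFD (FINITE GRADING GROUP) HAS FINITELY MANY
# TRACE IDEALS OF DIVISORIAL IDEALS (the `hfin` slot of the (S1) class-group centre, for `κ'[[P]] = κ'[[x,y,z]]₀`)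

Setting: `A` a commutative ring graded by `𝒜 : ι → σ` over a commutative group `ι`, `A` a LOCAL DOMAIN and a UFD; `R` a Noetherian domain mapped
injectively onto the degree-zero part `𝒜 0`, with `A ∩ Frac R = R` (`hFrac`; e.g. `R` integrally closed and `A` integral over `R`,
`…DivisorialGcd.exists_algebraMap_eq_of_isIntegrallyClosed`). The model: `A = κ'[[y₁,y₂,y₃]]` with the `ℤ/r`-grading of weights `(1,a,b)`, `R = A₀ = κ'[[P]] ≅ Ê`.

* `colon_span_singleton_eq_of_gcd` / `colon_span_singleton_span_singleton` — the two colon computations `((a) : I A) = (a/d)` and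
  `((a) : (a/d)) = (d)` for the gcd `d` of a divisorial `I ∋ a` (any domain);
* ★ `exists_homogeneous_cut` — **every nonzero divisorial ideal `I` of `R` is cut out by a HOMOGENEOUS element**: `∃ w, ∃ 0 ≠ d ∈ 𝒜 w,
  x ∈ I ⟺ d ∣ x` (the reflexive hull `((a) : ((a) : I A)) = (gcd I)` is homogeneous and principal, so has a homogeneous generator over the
  local ring `A`, `…GradedLocalPrincipal.exists_homogeneous_generator`);
* `nonempty_linearEquiv_of_mem_iff_dvd` — then `I ≅ M_d = {s : d s ∈ R}` (division by `d`), and `comap_mulLeft_eq_of_mem_grade` — `M_d` only depends on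
  `deg d` (it is `𝒜 (−deg d)`);
* ★★★ `finite_traceIdeals_divisorial` — hence for `ι` FINITE the set `𝒯 = {τ(I) : I ≠ 0 divisorial}` of trace ideals is FINITE (at most `|ι|`
  values): divisorial ideals with cuts of the same degree are isomorphic, and `τ` is an isomorphism invariant (p839642).

So the `hfin` input of `…CompletionDomain.hloc_of_traceIdealCentre_then_finite_singularPoints_of_isIntegrallyClosed` (p840173) holds for every
`Ê` that is the degree-zero part of a finitely graded complete regular local ring in the above sense — what remains for the twisted isolated
3-fold points is to EXHIBIT that graded structure on `Ê ⊆ κ'[[y₁,y₂,y₃]]` (Kato/Luna: `Ê ≅ κ'[[P]]`) and the fan facts. Honest label: general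
graded commutative algebra toward ONE leaf stub (no stub, crux or summit closed). No definitions, no named facts, no sorry.
[folklore; cite: BrunsHerzog1993, §1.5] [cite: Matsumura1987, §11; Thm. 20.3] [cite: StacksProject, Tag 0AFW]
-/

-- single-problem summit: the doubled namespace component is forced
set_option linter.dupNamespace false

open DirectSum SetLike
open Summit.ResolutionOfSingularities.ResolutionOfSingularities.Theorems.FRationalResolution

namespace Summit.ResolutionOfSingularities.ResolutionOfSingularities.Theorems.FRationalResolution.GradedDivisorialFinite

universe u

/-! ## §1 Two colon computations in a domain -/

/-- `((d a') : J) = (a')` when `d` divides `J`, is a «gcd» of `J` (`c ∣ s y` for all `y ∈ J` forces `c ∣ s d`) and `d ≠ 0`. [folklore] -/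
theorem colon_span_singleton_eq_of_gcd {A : Type*} [CommRing A] [IsDomain A] (J : Ideal A) {d a' : A} (hd0 : d ≠ 0)
    (hJd : ∀ y ∈ J, d ∣ y) (hgcd : ∀ s c : A, (∀ y ∈ J, c ∣ s * y) → c ∣ s * d) :
    (Ideal.span {d * a'}).colon J = Ideal.span {a'} := by
  apply le_antisymm
  · intro s hs
    rw [Submodule.mem_colon] at hs
    have h1 : d * a' ∣ s * d := hgcd s (d * a') fun y hy => Ideal.mem_span_singleton.mp (by
      have := hs y hy
      rwa [smul_eq_mul] at this)
    rw [Ideal.mem_span_singleton]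
    rw [mul_comm s d] at h1
    exact (mul_dvd_mul_iff_left hd0).mp h1
  · rw [Ideal.span_singleton_le_iff_mem, Submodule.mem_colon]
    intro y hy
    obtain ⟨y', rfl⟩ := hJd y hy
    rw [smul_eq_mul, Ideal.mem_span_singleton]
    exact ⟨y', by ring⟩

/-- `((d a') : (a')) = (d)` for `a' ≠ 0`. [folklore] -/
theorem colon_span_singleton_span_singleton {A : Type*} [CommRing A] [IsDomain A] {d a' : A} (ha' : a' ≠ 0) :
    (Ideal.span {d * a'}).colon (Ideal.span {a'}) = Ideal.span {d} := by
  apply le_antisymm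
  · intro s hs
    rw [Submodule.mem_colon] at hs
    have h1 := hs a' (Ideal.mem_span_singleton_self a')
    rw [smul_eq_mul, Ideal.mem_span_singleton] at h1
    exact Ideal.mem_span_singleton.mpr ((mul_dvd_mul_iff_right ha').mp h1)
  · rw [Ideal.span_singleton_le_iff_mem, Submodule.mem_colon]
    intro y hy
    obtain ⟨t, rfl⟩ := Ideal.mem_span_singleton'.mp hy
    rw [smul_eq_mul, Ideal.mem_span_singleton]
    exact ⟨t, by ring⟩

/-! ## §2 Every nonzero divisorial ideal of `R = 𝒜 0` is cut out by a homogeneous element -/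

section Graded

variable {ι σ : Type*} {A : Type u} [CommRing A] [SetLike σ A] [AddSubmonoidClass σ A] (𝒜 : ι → σ) [DecidableEq ι]
  [AddCommGroup ι] [GradedRing 𝒜]

/-- ★ **A homogeneous cut.** `A` a graded LOCAL domain and UFD, `R → 𝒜 0 ⊆ A` injective with `A ∩ Frac R = R`, `I` a nonzero finitely generated
divisorial ideal of `R`: there are `w` and `0 ≠ d ∈ 𝒜 w` with `x ∈ I ⟺ d ∣ x` for all `x ∈ R`. [folklore; cite: BrunsHerzog1993, §1.5] -/
theorem exists_homogeneous_cut [IsDomain A] [IsLocalRing A] [UniqueFactorizationMonoid A]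
    {R : Type u} [CommRing R] [IsDomain R] [Algebra R A] (hinj : Function.Injective (algebraMap R A))
    (hR0 : ∀ r : R, algebraMap R A r ∈ 𝒜 0)
    (hFrac : ∀ (x : A) (r₁ r₂ : R), r₂ ≠ 0 → algebraMap R A r₂ * x = algebraMap R A r₁ → ∃ r : R, algebraMap R A r = x)
    (I : Ideal R) (hI : I ≠ ⊥)
    (hdiv : ∀ x : R, (∀ c b : R, (∀ y ∈ I, b * y ∈ Ideal.span ({c} : Set R)) → b * x ∈ Ideal.span ({c} : Set R)) → x ∈ I)
    (G : Finset R) (hG : Ideal.span (G : Set R) = I) :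
    ∃ w : ι, ∃ d : A, d ∈ 𝒜 w ∧ d ≠ 0 ∧ ∀ x : R, x ∈ I ↔ d ∣ algebraMap R A x := by
  classical
  letI : GCDMonoid A := UniqueFactorizationMonoid.toGCDMonoid A
  have hmem := DivisorialGcd.mem_iff_gcd_dvd_of_divisorial hinj hFrac I hdiv G hG
  obtain ⟨d₀, hd₀⟩ : ∃ d₀ : A, (G.toList.map (algebraMap R A)).foldr gcd 0 = d₀ := ⟨_, rfl⟩
  rw [hd₀] at hmem
  -- a nonzero element `a ∈ I`, `a = d₀ a'`
  obtain ⟨a, haI, ha0⟩ := Submodule.exists_mem_ne_zero_of_ne_bot hI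
  obtain ⟨a', ha'⟩ := (hmem a).mp haI
  have hA0 : algebraMap R A a ≠ 0 := fun h => ha0 (hinj (by rw [h, map_zero]))
  have hd₀0 : d₀ ≠ 0 := fun h => hA0 (by rw [ha', h, zero_mul])
  have ha'0 : a' ≠ 0 := fun h => hA0 (by rw [ha', h, mul_zero])
  -- `J = I A` is homogeneous (generated in degree 0), divisible by `d₀`, with gcd `d₀`
  set J : Ideal A := I.map (algebraMap R A) with hJ
  have hJhom : J.IsHomogeneous 𝒜 :=
    Ideal.homogeneous_span 𝒜 _ fun x hx => by
      obtain ⟨r, -, rfl⟩ := hx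
      exact ⟨0, hR0 r⟩
  have hJd : ∀ y ∈ J, d₀ ∣ y := by
    intro y hy
    have hle : J ≤ Ideal.span {d₀} := by
      rw [hJ, Ideal.map_le_iff_le_comap]
      intro x hx
      exact Ideal.mem_span_singleton.mpr ((hmem x).mp hx)
    exact Ideal.mem_span_singleton.mp (hle hy)
  have hgcd : ∀ s c : A, (∀ y ∈ J, c ∣ s * y) → c ∣ s * d₀ := by
    intro s c h
    rw [← hd₀]
    refine TraceIdealDivisorial.dvd_mul_foldr_gcd _ _ _ fun g hg => ?_
    obtain ⟨g', hg', rfl⟩ := List.mem_map.mp hg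
    exact h _ (Ideal.mem_map_of_mem _ (hG ▸ Ideal.subset_span (Finset.mem_toList.mp hg')))
  -- the reflexive hull `((a) : ((a) : J)) = (d₀)` is homogeneous
  have hK : (Ideal.span {algebraMap R A a}).colon J = Ideal.span {a'} := by
    rw [ha']
    exact colon_span_singleton_eq_of_gcd J hd₀0 hJd hgcd
  have hH : (Ideal.span {algebraMap R A a}).colon ((Ideal.span {algebraMap R A a}).colon J) = Ideal.span {d₀} := by
    rw [hK, ha']
    exact colon_span_singleton_span_singleton ha'0
  have hahom : (Ideal.span {algebraMap R A a}).IsHomogeneous 𝒜 := GradedLocalPrincipal.isHomogeneous_span_singleton 𝒜 (hR0 a)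
  have hHhom : (Ideal.span ({d₀} : Set A)).IsHomogeneous 𝒜 := by
    rw [← hH]
    exact GradedLocalPrincipal.isHomogeneous_colon 𝒜 hahom (GradedLocalPrincipal.isHomogeneous_colon 𝒜 hahom hJhom)
  -- hence a homogeneous generator `d ~ d₀`
  obtain ⟨w, d, hdw, hdeq⟩ := GradedLocalPrincipal.exists_homogeneous_generator 𝒜 hHhom rfl hd₀0
  have hassoc : Associated d₀ d := Ideal.span_singleton_eq_span_singleton.mp hdeq
  refine ⟨w, d, hdw, hassoc.ne_zero_iff.mp hd₀0, fun x => ?_⟩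
  rw [hmem x]
  exact hassoc.dvd_iff_dvd_left

/-! ## §3 `I ≅ M_d`, and `M_d` only depends on the degree of `d` -/

/-- **Division by a cut is an isomorphism `I ≅ M_d = {s : d s ∈ R}`** (abstract form of `…DivisorialGcd.nonempty_linearEquiv_of_divisorial`).
[folklore] -/
theorem nonempty_linearEquiv_of_mem_iff_dvd [IsDomain A] {R : Type u} [CommRing R] [Algebra R A]
    (hinj : Function.Injective (algebraMap R A)) (I : Ideal R) {d : A} (hd0 : d ≠ 0)
    (hmem : ∀ x : R, x ∈ I ↔ d ∣ algebraMap R A x) :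
    Nonempty (I ≃ₗ[R] ↥((LinearMap.range (Algebra.linearMap R A)).comap (LinearMap.mulLeft R d))) := by
  have hex : ∀ x : I, ∃ t : A, algebraMap R A x = d * t := fun x => (hmem x).mp x.2
  choose q hq using hex
  have hqu : ∀ (x : I) (t : A), algebraMap R A x = d * t → t = q x := fun x t ht =>
    mul_left_cancel₀ hd0 (ht.symm.trans (hq x))
  have hqmem : ∀ x : I, q x ∈ (LinearMap.range (Algebra.linearMap R A)).comap (LinearMap.mulLeft R d) := fun x =>
    ⟨(x : R), by rw [Algebra.linearMap_apply, LinearMap.mulLeft_apply, hq x]⟩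
  let ψ : I →ₗ[R] ↥((LinearMap.range (Algebra.linearMap R A)).comap (LinearMap.mulLeft R d)) :=
    { toFun := fun x => ⟨q x, hqmem x⟩
      map_add' := fun x y => by
        ext
        change q (x + y) = q x + q y
        refine (hqu (x + y) _ ?_).symm
        rw [Submodule.coe_add, map_add, hq x, hq y, mul_add]
      map_smul' := fun a x => by
        ext
        change q (a • x) = a • q x
        refine (hqu (a • x) _ ?_).symm
        rw [SetLike.val_smul, smul_eq_mul, map_mul, hq x, Algebra.smul_def, mul_left_comm] }
  refine ⟨LinearEquiv.ofBijective ψ ⟨?_, ?_⟩⟩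
  · intro x y hxy
    have h : q x = q y :=
      congrArg (fun z : ↥((LinearMap.range (Algebra.linearMap R A)).comap (LinearMap.mulLeft R d)) => (z : A)) hxy
    apply Subtype.ext
    apply hinj
    rw [hq x, hq y, h]
  · rintro ⟨s, ⟨r, hr⟩⟩
    rw [Algebra.linearMap_apply, LinearMap.mulLeft_apply] at hr
    have hrI : r ∈ I := (hmem r).mpr ⟨s, hr⟩
    refine ⟨⟨r, hrI⟩, Subtype.ext ?_⟩
    change q ⟨r, hrI⟩ = s
    exact (hqu ⟨r, hrI⟩ s hr).symm

/-- **`M_d = M_{d'}` for homogeneous cuts of the same degree** (both are `𝒜 (−w)`, `…GradedLocalPrincipal.mul_mem_grade_zero_iff`). [folklore] -/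
theorem comap_mulLeft_eq_of_mem_grade [IsDomain A] {R : Type u} [CommRing R] [Algebra R A]
    (hR0 : ∀ r : R, algebraMap R A r ∈ 𝒜 0) (hR0' : ∀ a : A, a ∈ 𝒜 0 → ∃ r : R, algebraMap R A r = a)
    {w : ι} {d d' : A} (hd : d ∈ 𝒜 w) (hd0 : d ≠ 0) (hd' : d' ∈ 𝒜 w) (hd'0 : d' ≠ 0) :
    (LinearMap.range (Algebra.linearMap R A)).comap (LinearMap.mulLeft R d) =
      (LinearMap.range (Algebra.linearMap R A)).comap (LinearMap.mulLeft R d') := by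
  have key : ∀ {e : A}, e ∈ 𝒜 w → e ≠ 0 → ∀ s : A,
      s ∈ (LinearMap.range (Algebra.linearMap R A)).comap (LinearMap.mulLeft R e) ↔ s ∈ 𝒜 (-w) := by
    intro e he he0 s
    rw [Submodule.mem_comap, LinearMap.mulLeft_apply, LinearMap.mem_range,
      ← GradedLocalPrincipal.mul_mem_grade_zero_iff 𝒜 he he0 s]
    constructor
    · rintro ⟨r, hr⟩
      rw [Algebra.linearMap_apply] at hr
      exact hr ▸ hR0 r
    · intro h
      obtain ⟨r, hr⟩ := hR0' _ h
      exact ⟨r, hr⟩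
  ext s
  rw [key hd hd0, key hd' hd'0]

/-! ## §4 Finiteness of the set of trace ideals -/

/-- ★★★ **Finitely many trace ideals of divisorial ideals.** `A` a commutative ring graded over a FINITE commutative group `ι`, `A` a local domain
and a UFD; `R` a Noetherian domain mapping injectively ONTO `𝒜 0` with `A ∩ Frac R = R`. Then the set of trace ideals
`τ(I) = Σ_{φ : I → R} φ(I)` of the nonzero divisorial ideals `I` of `R` is finite (at most `|ι|` values). [folklore; cite: BrunsHerzog1993, §1.5]
[cite: Matsumura1987, §11] -/
theorem finite_traceIdeals_divisorial [Finite ι] [IsDomain A] [IsLocalRing A] [UniqueFactorizationMonoid A]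
    {R : Type u} [CommRing R] [IsDomain R] [IsNoetherianRing R] [Algebra R A] (hinj : Function.Injective (algebraMap R A))
    (hR0 : ∀ r : R, algebraMap R A r ∈ 𝒜 0) (hR0' : ∀ a : A, a ∈ 𝒜 0 → ∃ r : R, algebraMap R A r = a)
    (hFrac : ∀ (x : A) (r₁ r₂ : R), r₂ ≠ 0 → algebraMap R A r₂ * x = algebraMap R A r₁ → ∃ r : R, algebraMap R A r = x) :
    Set.Finite {T : Ideal R | ∃ I : Ideal R,
      (I ≠ ⊥ ∧ ∀ x : R, (∀ c b : R, (∀ y ∈ I, b * y ∈ Ideal.span ({c} : Set R)) → b * x ∈ Ideal.span ({c} : Set R)) → x ∈ I) ∧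
      T = ⨆ φ : I →ₗ[R] R, LinearMap.range φ} := by
  classical
  -- the trace ideals of the divisorial ideals cut out in degree `w`
  let 𝒯 : ι → Set (Ideal R) := fun w => {T | ∃ I : Ideal R, (∃ d : A, d ∈ 𝒜 w ∧ d ≠ 0 ∧ ∀ x : R, x ∈ I ↔ d ∣ algebraMap R A x) ∧
    T = ⨆ φ : I →ₗ[R] R, LinearMap.range φ}
  -- each is a subsingleton: same degree ⇒ isomorphic ⇒ same trace ideal
  have hsub : ∀ w, (𝒯 w).Subsingleton := by
    intro w T₁ hT₁ T₂ hT₂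
    obtain ⟨I₁, ⟨d₁, hd₁, hd₁0, hm₁⟩, rfl⟩ := hT₁
    obtain ⟨I₂, ⟨d₂, hd₂, hd₂0, hm₂⟩, rfl⟩ := hT₂
    obtain ⟨e₁⟩ := nonempty_linearEquiv_of_mem_iff_dvd hinj I₁ hd₁0 hm₁
    obtain ⟨e₂⟩ := nonempty_linearEquiv_of_mem_iff_dvd hinj I₂ hd₂0 hm₂
    have heq := comap_mulLeft_eq_of_mem_grade 𝒜 hR0 hR0' hd₁ hd₁0 hd₂ hd₂0
    exact TraceIdealBasics.traceIdeal_eq_of_linearEquiv ((e₁.trans (LinearEquiv.ofEq _ _ heq)).trans e₂.symm)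
  refine (Set.finite_iUnion fun w => (hsub w).finite).subset ?_
  rintro T ⟨I, ⟨hI, hdiv⟩, rfl⟩
  obtain ⟨G, hG⟩ := (IsNoetherian.noetherian I : I.FG)
  obtain ⟨w, d, hdw, hd0, hm⟩ := exists_homogeneous_cut 𝒜 hinj hR0 hFrac I hI hdiv G hG
  exact Set.mem_iUnion.mpr ⟨w, I, ⟨d, hdw, hd0, hm⟩, rfl⟩

end Graded

end Summit.ResolutionOfSingularities.ResolutionOfSingularities.Theorems.FRationalResolution.GradedDivisorialFinite
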